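import Literature.MathematicalPhysics.KineticTheory.LangevinChainNESSProofs
import Literature.Probability.Process.KrylovBogoliubov
import HarnessLib

/-!
# The pinned chain: Lyapunov condition, hypoelliptic regularity, and Theorem 2.13 (2) proved

Trunk T-KINETIC (Literature/MathematicalPhysics/KineticTheory). Second decomposition step for the
named fact `CuneoEckmannHairerReyBellet2018_pinnedChain` (`LangevinChainNESS.lean`; provefact
unit `Literature.MathematicalPhysics.KineticTheory.HeatConduction.CuneoEckmannHairerReyBellet2018_pinnedChain`). The first step
(`LangevinChainNESSProofs.lean`) reduced the fact to Theorem 2.13 of Cuneo–Eckmann–Hairer–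
Rey-Bellet 2018 as a whole (`CuneoEckmannHairerReyBellet2018_thm213`: existence, uniqueness,
smoothness, exponential convergence). The printed proof of Theorem 2.13 (= Thm 3.1) has three
independent inputs (§3, p. 7): the Hörmander bracket condition H1 (Prop. 4.1 ⇒ Props. 3.2, 3.3,
3.6), the Lyapunov condition H2 for `V = e^{θH}` (Thm 5.1 ⇒ Prop. 3.7 by Krylov–Bogoliubov), and
Harris' theorem (Prop. 3.8). The weak-stationarity fact needs only EXISTENCE of an invariant
probability measure with exponential moments (H2 + Krylov–Bogoliubov) and its SMOOTH DENSITY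
(H1 + Hörmander). This file vendors the two analytic inputs as separate named facts and PROVES
the rest:

* `CuneoEckmannHairerReyBellet2018_lyapunov` — NAMED FACT (§3 p. 7, eq. (3.4); p. 9 "the process
  is Feller"; Thm 5.1 / Rem 5.2): there is a Feller Markov semigroup `S` of
  `pinnedChain ω₂ lam β γ` (interface `LangevinChainSemigroup`, existential packaging as in
  `LangevinSemigroup.lean`) such that for every `0 < θ < 1/max(T_L,T_R)`,
  `E_z e^{θH(z_t)} ≤ e^{θγ(T_L+T_R)t} e^{θH(z)}` (3.4) and, for every `t* > 0`,
  `E_z e^{θH(z_{t*})} ≤ κ e^{θH(z)} + c 1_K(z)` with `κ ∈ (0,1)`, `c > 0`, `K` compact (H2).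
* `CuneoEckmannHairerReyBellet2018_smoothDensity` — NAMED FACT (Hörmander 1967, Thm 1.1,
  applied to `L*`, whose bracket condition is H1 = Prop. 4.1; Prop. 3.2 prints the corollary for
  invariant measures): every finite Borel measure `μ` on phase space which is stationary in the
  sense of distributions, `∫ L f dμ = 0` for `f ∈ C_c^∞`, has a smooth density.
* `CuneoEckmannHairerReyBellet2018_lyapunov.exists_isInvariant` — PROVED: Theorem 2.13 (2) for
  the pinned chain ("admits at least one invariant measure, and `e^{ϑH}` is integrable with
  respect to it for all `0 < ϑ < 1/T_max`"), from the Lyapunov fact by the Krylov–Bogoliubov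
  theorem of `Literature/Probability/Process/KrylovBogoliubov.lean`
  (`Literature.Probability.Process.MarkovSemigroup.exists_invariant_of_lyapunov`, applied to the whole family
  `(e^{ϑH})_{0<ϑ<1/T_max}` at once, so that ONE invariant measure integrates all of them — the
  printed route to "for all `ϑ`" goes through uniqueness instead).
* `CuneoEckmannHairerReyBellet2018_smoothDensity.hasSmoothDensity_of_isInvariant` — PROVED: the
  printed sentence of Prop. 3.2 ("every invariant measure has a smooth density") for invariant
  finite measures of any Markov semigroup of the chain (they are weakly stationary by Dynkin's
  identity, `LangevinChainSemigroup.IsInvariant.integral_generator_eq_zero`).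
* `CuneoEckmannHairerReyBellet2018_pinnedChain_of_lyapunov_of_smoothDensity` — PROVED: the two
  named facts imply `CuneoEckmannHairerReyBellet2018_pinnedChain`.
* `pinnedChain_isCompact_setOf_hamiltonian_le` — PROVED: `H` has compact level sets
  (`ω₂ > 0`, `lam, β ≥ 0`), the standing assumption of §3.

So the discharge of the fact is now reduced to: (a) the construction of the transition semigroup
of the SDE (2.2) with the Feller property and the bounds (3.4), H2 — strong solutions of an SDE
with locally Lipschitz coefficients and a Lyapunov function, Itô's formula, and the high-energy
analysis of §5 (no SDE solution theory in Mathlib yet); (b) Hörmander's hypoellipticity theorem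
for `L*` (no such theory in Mathlib yet) together with the bracket computation of Prop. 4.1.

## References

* N. Cuneo, J.-P. Eckmann, M. Hairer, L. Rey-Bellet, *Non-equilibrium steady states for
  networks of oscillators*, Electron. J. Probab. 23 (2018) no. 55 (arXiv:1712.09413): §3
  (eqs. (3.3)–(3.4), conditions H1, H2, Thm 3.1), Prop. 3.2, §3.3 (3.5)–(3.6) and Prop. 3.7,
  Prop. 4.1, Thm 5.1 and Remark 5.2. Page numbers "p. 7", "p. 9" in this file refer to the
  arXiv version (arXiv pagination), not to the EJP article; the `[cite]` locators use only
  §/eq./Prop./Thm. numbers, which agree.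
* L. Hörmander, *Hypoelliptic second order differential equations*, Acta Math. 119 (1967)
  147–171: p. 147 ("`P` … is called hypoelliptic if for every distribution `u` in `Ω` we have
  sing supp `u` = sing supp `Pu`"), form (1.6) `P = ∑₁ʳ X_j² + X_0 + c` and Thm 1.1 (p. 149).
* P. Carmona, *Existence and uniqueness of an invariant measure for a chain of oscillators in
  contact with two heat baths*, Stoch. Proc. Appl. 117 (2007) 1076–1092 (arXiv:math/0611689), §3
  ("The invariant measures, if they exist, also have a smooth density").

## Design choices and wording risks

* Both facts use the parameter ranges of `CuneoEckmannHairerReyBellet2018_thm213`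
  (`ω₂, β, γ > 0`, `lam ≥ 0`, `N ≥ 1`, `T_L, T_R > 0`), under which C1–C5 hold.
* Expectations `E_z e^{θH(z_t)} = ∫ e^{θH} dP_t(z, ·)` of the nonnegative functional are Lebesgue
  integrals `∫⁻ … ∂(S.kernel t z)` with values in `ℝ≥0∞`; the printed right-hand sides are
  wrapped in `ENNReal.ofReal` (they are nonnegative reals). No junk values arise.
* `C_* = θ ∑_{b ∈ B} γ_b T_b` is `θγ(T_L + T_R)` for the path graph with `B = {0, N-1}`; for
  `N = 1` both bath terms of `OscillatorChain.generator` act on the single site and (3.3) reads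
  `LV = θγ([θ(T_L+T_R) - 2]p² + T_L + T_R)V ≤ θγ(T_L+T_R)V` since `θ < 1/max(T_L,T_R)`.
* H2 is vendored in the form of Remark 5.2 ("the usual Lyapunov condition used in H2"), for
  every `t* > 0` (§5: "We fix `t_* > 0` and `θ < 1/T_max`"), not in the sharper large-energy
  form (5.1) of Thm 5.1.
* The smooth-density fact is vendored in the distributional form given by Hörmander's
  Thm 1.1 for `L*` (cited as such), from which the printed sentence of CEHR Prop. 3.2 about
  invariant measures is DERIVED here; it is this form that applies to the Krylov–Bogoliubov
  measure of an abstract `LangevinChainSemigroup` (whose invariant measures are weakly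
  stationary, nothing more being known about the interface) and to weak steady states
  (`absolutelyContinuous_of_isSteadyState`). `HasSmoothDensity` is the notion of
  `LangevinSemigroup.lean`.
* The Lyapunov fact is a separate existential statement about "a" semigroup of the chain, as is
  `CuneoEckmannHairerReyBellet2018_thm213`; combining the two witnesses is not needed here (see
  the discussion "WHY `∃ S`" in `LangevinSemigroup.lean`).
-/

noncomputable section

open MeasureTheory ProbabilityTheory Filter Topology Set
open scoped ContDiff NNReal ENNReal BoundedContinuousFunction

namespace Literature.MathematicalPhysics.KineticTheory.HeatConduction

/-! ### Named fact: the transition semigroup and its Lyapunov function `e^{θH}` -/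

/-- NAMED FACT — **Cuneo–Eckmann–Hairer–Rey-Bellet 2018, §3 p. 7 with Theorem 5.1 / Remark 5.2
(the Feller transition semigroup of the pinned chain and the Lyapunov condition H2 for
`V = e^{θH}`)**, for `pinnedChain ω₂ lam β γ` (`ω₂, β, γ > 0`, `lam ≥ 0`, `N ≥ 1`,
`T_L, T_R > 0`; Conditions C1, C3–C5 hold: chain with baths at its ends, `U, V` nearly
homogeneous of degrees `ℓ_p ∈ {2,4} ≤ ℓ_i = 4` with coercive limits, `n = 1`). Printed:
(p. 7) "the process admits strong solutions that are continuous and defined for all `t ≥ 0`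
(almost surely), the strong Markov property is satisfied, and for all `t ≥ 0` we have
`P^t V ≤ e^{C_* t} V` (3.4)", where `V = e^{θH}`, `0 < θ < 1/T_max`, `C_* = θ ∑_{b∈B} γ_b T_b`
(from (3.3) `LV = ∑_b θγ_b([θT_b - 1]p_b² + T_b)e^{θH} ≤ C_* V`); (p. 9) "the process is Feller";
(Thm 5.1, "We fix `t_* > 0` and `θ < 1/T_max`") "Under Conditions C1, C3, C4 and C5, there is a
constant `C₁ > 0` such that for all `z₀` such that `H(z₀)` is large enough, we have
`E_{z₀} e^{θH(z_{t*}) - θH(z₀)} ≤ e^{-C₁H(z₀)}`"; (Remark 5.2) "By the coercivity of `H`, the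
theorem above implies that there exist constants `κ ∈ (0,1)` and `c > 0`, and a compact set `K`
such that `E_z e^{θH(z_{t*})} ≤ κ e^{θH(z)} + c 1_K(z)`, which is the usual Lyapunov condition
used in H2."
Vendored, like `CuneoEckmannHairerReyBellet2018_thm213`, EXISTENTIALLY over the interface
`LangevinChainSemigroup` (the transition semigroup (2.3) of the SDE (2.2) is such an object):
there is a Markov semigroup `S` of the chain which is Feller (`P_t` maps bounded continuous
functions to continuous ones) and such that for every `0 < θ < 1/max(T_L,T_R)`:
(3.4) `E_z e^{θH(z_t)} ≤ e^{θγ(T_L+T_R)t} e^{θH(z)}` for all `t, z` (for the path graph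
`∑_b γ_b T_b = γ(T_L + T_R)`, also for `N = 1` where both baths act on the single site), and
(H2) for every `t* > 0` there are `κ ∈ (0,1)`, `c > 0` and a compact `K` with
`E_z e^{θH(z_{t*})} ≤ κ e^{θH(z)} + c 1_K(z)` for all `z`. Expectations of the nonnegative
functional `e^{θH}` are written as Lebesgue integrals `∫⁻` against the transition kernels (no
integrability side condition). Users take `(h : CuneoEckmannHairerReyBellet2018_lyapunov)`; with
the Krylov–Bogoliubov theorem (`Literature/Probability/Process/KrylovBogoliubov.lean`) it yields
Theorem 2.13 (2) for the pinned chain (`CuneoEckmannHairerReyBellet2018_lyapunov.exists_isInvariant`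
below). [cite: CuneoEckmannHairerReyBellet2018, Thm 5.1, Rem 5.2 and §3 eq. (3.4)] -/
def CuneoEckmannHairerReyBellet2018_lyapunov : Prop :=
  ∀ ω₂ lam β γ : ℝ, 0 < ω₂ → 0 ≤ lam → 0 < β → 0 < γ →
    ∀ (N : ℕ) (T_L T_R : ℝ), 0 < N → 0 < T_L → 0 < T_R →
      ∃ S : LangevinChainSemigroup (pinnedChain ω₂ lam β γ) N T_L T_R,
        -- the transition semigroup is Feller (p. 9)
        (∀ (t : ℝ≥0) (g : PhaseSpace N →ᵇ ℝ), Continuous (S.act t g)) ∧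
        ∀ θ : ℝ, 0 < θ → θ < 1 / max T_L T_R →
          -- (3.4): `P^t V ≤ e^{C_* t} V`, `V = e^{θH}`, `C_* = θ γ (T_L + T_R)`
          (∀ (t : ℝ≥0) (z : PhaseSpace N),
            ∫⁻ y, ENNReal.ofReal (Real.exp (θ * (pinnedChain ω₂ lam β γ).hamiltonian N y))
                ∂(S.kernel t z) ≤
              ENNReal.ofReal (Real.exp (θ * γ * (T_L + T_R) * t) *
                Real.exp (θ * (pinnedChain ω₂ lam β γ).hamiltonian N z))) ∧
          -- Thm 5.1 / Rem 5.2 (H2): for every `t* > 0`, `P^{t*} V ≤ κ V + c 1_K`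
          ∀ tstar : ℝ≥0, 0 < tstar →
            ∃ (κ c : ℝ) (K : Set (PhaseSpace N)), 0 < κ ∧ κ < 1 ∧ 0 < c ∧ IsCompact K ∧
              ∀ z : PhaseSpace N,
                ∫⁻ y, ENNReal.ofReal (Real.exp (θ * (pinnedChain ω₂ lam β γ).hamiltonian N y))
                    ∂(S.kernel tstar z) ≤
                  ENNReal.ofReal (κ * Real.exp (θ * (pinnedChain ω₂ lam β γ).hamiltonian N z) +
                    c * K.indicator 1 z)

/-! ### Named fact: hypoelliptic regularity of stationary measures -/

/-- NAMED FACT — **smooth density of stationary measures of the pinned chain (Hörmander 1967,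
Thm 1.1, for `L*`; Cuneo–Eckmann–Hairer–Rey-Bellet 2018, Prop. 4.1 for the bracket condition,
Prop. 3.2 for the printed corollary).** Printed: (Prop. 4.1)
"Under Conditions C1 and C2, the system (2.2) satisfies H1", H1 being Hörmander's bracket
condition for `L = X_0 + ∑_{b,i} X_{b,i}²`, `X_{b,i} = √(T_bγ_b) ∂_{p_b^i}` ("for every `z ∈ Ω`,
there exists an integer `k > 0` such that the linear span of `{Y(z) : Y ∈ A_k}` is all of `Ω`",
`A_0 = {X_{b,i}}`, `A_{k+1} = A_k ∪ {[X, Y] : X ∈ A_k, Y ∈ A_0 ∪ {X_0}}`); (Prop. 3.2, "well known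
[Hörmander 1967]") "Assume H1. Then the transition kernel … `p_t(z,z')` is smooth … In particular,
the process is strong Feller. Finally, every invariant measure has a smooth density with respect
to Lebesgue measure on `Ω`" (likewise Carmona 2007, §3: "The invariant measures, if they exist,
also have a smooth density"). The statement vendored is the underlying DISTRIBUTIONAL theorem,
Hörmander 1967, Thm 1.1 (p. 149): "Let `P` be written in the form (1.6)
[`P = ∑₁ʳ X_j² + X_0 + c`, `X_0, …, X_r` first order homogeneous differential operators in an open
set `Ω ⊂ Rⁿ` with `C^∞` coefficients, `c ∈ C^∞(Ω)`] and assume that among the operators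
`X_{j₁}, [X_{j₁}, X_{j₂}], [X_{j₁}, [X_{j₂}, X_{j₃}]], …` where `jᵢ = 0, 1, …, r`, there exist `n`
which are linearly independent at any given point in `Ω`. Then it follows that `P` is
hypoelliptic" (p. 147: "for every distribution `u` in `Ω` … `u` must be a `C^∞` function in every
open set where `Pu` is a `C^∞` function"), applied to the formal adjoint of the generator
(CEHR p. 8: "`L*` is the formal adjoint of the generator"): with `X_b = √(γT_b) ∂_{p_b}`
(constant coefficients, so `X_b* = -X_b`) and `div X_0 = -∑_b γ_b` one has
`L* = ∑_b X_b² - X_0 + ∑_b γ_b`, which is of the form (1.6) with the vector fields `-X_0, X_b`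
generating the same brackets as `X_0, X_b`; these span at every point by H1, which holds for the
pinned chain by Prop. 4.1 (`ω₂, β, γ > 0`, `lam ≥ 0`, `N ≥ 1`, `T_L, T_R > 0`: C1 for the chain
with baths at its end(s), C2 since `V'' = 1 + 3βr² > 0`; H1's family `A_k` is contained in
Hörmander's). A finite Borel measure `μ` with `∫ L f dμ = 0` for all `f ∈ C_c^∞` is a
distribution with `L*μ = 0 ∈ C^∞`, hence a `C^∞` function `ρ`; positivity of `μ` gives `ρ ≥ 0`,
and `μ = ρ · Leb` as measures (both are determined by their integrals of test functions), i.e.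
`HasSmoothDensity μ`. So: every finite Borel measure `μ` on phase space with `∫ L f dμ = 0` for
all `f ∈ C_c^∞` has a smooth density. The printed sentence of Prop. 3.2 about invariant measures
is derived from it below (`hasSmoothDensity_of_isInvariant`).
[cite: Hormander1967, Thm 1.1] [cite: CuneoEckmannHairerReyBellet2018, Prop 3.2 and Prop 4.1] -/
def CuneoEckmannHairerReyBellet2018_smoothDensity : Prop :=
  ∀ ω₂ lam β γ : ℝ, 0 < ω₂ → 0 ≤ lam → 0 < β → 0 < γ →
    ∀ (N : ℕ) (T_L T_R : ℝ), 0 < N → 0 < T_L → 0 < T_R →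
      ∀ μ : Measure (PhaseSpace N), IsFiniteMeasure μ →
        (∀ f : PhaseSpace N → ℝ, ContDiff ℝ ∞ f → HasCompactSupport f →
            ∫ x, (pinnedChain ω₂ lam β γ).generator N T_L T_R f x ∂μ = 0) →
        HasSmoothDensity μ

/-! ### The Hamiltonian of the pinned chain has compact level sets -/

section Pinned

variable {ω₂ lam β : ℝ}

/-- A sublevel set `{H ≤ E}` of the pinned chain (`ω₂ > 0`, `lam, β ≥ 0`) lies in the closed
ball of radius `max(√(2E/ω₂), √(2E))` of phase space (sup norm): `ω₂ q_i²/2, p_i²/2 ≤ H`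
(for `E < 0` the set is empty and the radius is `0`). [folklore] -/
theorem pinnedChain_setOf_hamiltonian_le_subset_closedBall (hω : 0 < ω₂) (hl : 0 ≤ lam)
    (hβ : 0 ≤ β) (γ : ℝ) (N : ℕ) (E : ℝ) :
    {x : PhaseSpace N | (pinnedChain ω₂ lam β γ).hamiltonian N x ≤ E} ⊆
      Metric.closedBall 0 (max (Real.sqrt (2 * E / ω₂)) (Real.sqrt (2 * E))) := by
  intro x hx
  rw [mem_setOf_eq] at hx
  have hH := (pinnedChain_harmonic_le_hamiltonian (ω₂ := ω₂) hl hβ γ N x).trans hx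
  have hq : ∀ i, ω₂ * x.1 i ^ 2 / 2 ≤ E := fun i => by
    have h1 : ω₂ * x.1 i ^ 2 / 2 ≤ ∑ j, ω₂ * x.1 j ^ 2 / 2 :=
      Finset.single_le_sum (f := fun j => ω₂ * x.1 j ^ 2 / 2) (fun j _ => by positivity)
        (Finset.mem_univ i)
    have h2 : (0 : ℝ) ≤ ∑ j, x.2 j ^ 2 / 2 := Finset.sum_nonneg fun j _ => by positivity
    linarith
  have hp : ∀ i, x.2 i ^ 2 / 2 ≤ E := fun i => by
    have h1 : x.2 i ^ 2 / 2 ≤ ∑ j, x.2 j ^ 2 / 2 :=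
      Finset.single_le_sum (f := fun j => x.2 j ^ 2 / 2) (fun j _ => by positivity)
        (Finset.mem_univ i)
    have h2 : (0 : ℝ) ≤ ∑ j, ω₂ * x.1 j ^ 2 / 2 := Finset.sum_nonneg fun j _ => by positivity
    linarith
  rw [Metric.mem_closedBall, dist_zero_right, Prod.norm_def, max_le_iff]
  constructor
  · refine (pi_norm_le_iff_of_nonneg (by positivity)).2 fun i => ?_
    rw [Real.norm_eq_abs]
    refine (le_max_left _ _).trans' ?_
    rw [← Real.sqrt_sq_eq_abs]
    exact Real.sqrt_le_sqrt (by rw [le_div_iff₀ hω]; nlinarith [hq i])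
  · refine (pi_norm_le_iff_of_nonneg (by positivity)).2 fun i => ?_
    rw [Real.norm_eq_abs]
    refine (le_max_right _ _).trans' ?_
    rw [← Real.sqrt_sq_eq_abs]
    exact Real.sqrt_le_sqrt (by nlinarith [hp i])

/-- **`H` has compact level sets** (Cuneo–Eckmann–Hairer–Rey-Bellet 2018, standing assumption of
§3, "`H` has compact level sets"): for the pinned chain with `ω₂ > 0`, `lam, β ≥ 0`, every
sublevel set `{H ≤ E}` is compact. [folklore] -/
theorem pinnedChain_isCompact_setOf_hamiltonian_le (hω : 0 < ω₂) (hl : 0 ≤ lam) (hβ : 0 ≤ β)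
    (γ : ℝ) (N : ℕ) (E : ℝ) :
    IsCompact {x : PhaseSpace N | (pinnedChain ω₂ lam β γ).hamiltonian N x ≤ E} := by
  have hclosed : IsClosed {x : PhaseSpace N | (pinnedChain ω₂ lam β γ).hamiltonian N x ≤ E} :=
    isClosed_le (pinnedChain_continuous_hamiltonian ω₂ lam β γ N) continuous_const
  exact (isCompact_closedBall _ _).of_isClosed_subset hclosed
    (pinnedChain_setOf_hamiltonian_le_subset_closedBall hω hl hβ γ N E)

/-- The Lyapunov function `e^{θH}` (`θ > 0`) of the pinned chain has compact sublevel sets.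
[folklore] -/
theorem pinnedChain_isCompact_setOf_exp_le (hω : 0 < ω₂) (hl : 0 ≤ lam) (hβ : 0 ≤ β)
    (γ : ℝ) (N : ℕ) {θ : ℝ} (hθ : 0 < θ) (R : ℝ≥0) :
    IsCompact {x : PhaseSpace N |
      (Real.exp (θ * (pinnedChain ω₂ lam β γ).hamiltonian N x)).toNNReal ≤ R} := by
  have hcont : Continuous fun x : PhaseSpace N =>
      (Real.exp (θ * (pinnedChain ω₂ lam β γ).hamiltonian N x)).toNNReal :=
    continuous_real_toNNReal.comp (Real.continuous_exp.comp
      (continuous_const.mul (pinnedChain_continuous_hamiltonian ω₂ lam β γ N)))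
  refine (pinnedChain_isCompact_setOf_hamiltonian_le hω hl hβ γ N
    (Real.log (max (R : ℝ) 1) / θ)).of_isClosed_subset (isClosed_le hcont continuous_const) ?_
  intro x hx
  rw [mem_setOf_eq, Real.toNNReal_le_iff_le_coe] at hx
  rw [mem_setOf_eq, le_div_iff₀ hθ, mul_comm, Real.le_log_iff_exp_le (by positivity)]
  exact hx.trans (le_max_left _ _)

/-! ### Theorem 2.13 (2) for the pinned chain, from the Lyapunov fact and Krylov–Bogoliubov -/

namespace CuneoEckmannHairerReyBellet2018_lyapunov

variable (h : CuneoEckmannHairerReyBellet2018_lyapunov) {ω₂ lam β γ : ℝ}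
  (hω : 0 < ω₂) (hl : 0 ≤ lam) (hβ : 0 < β) (hγ : 0 < γ)
  {N : ℕ} (hN : 0 < N) {T_L T_R : ℝ} (hL : 0 < T_L) (hR : 0 < T_R)
include h hω hl hβ hγ hN hL hR

/-- **Cuneo–Eckmann–Hairer–Rey-Bellet 2018, Theorem 2.13 (2) for the pinned chain, PROVED from
the Lyapunov fact by the Krylov–Bogoliubov theorem (their Prop. 3.7).** There is a Feller Markov
semigroup of `pinnedChain ω₂ lam β γ` with an invariant probability measure `μ⋆` such that
`e^{ϑH} ∈ L¹(μ⋆)` for EVERY `0 < ϑ < 1/max(T_L, T_R)` ("the system (2.2) admits at least one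
invariant measure, and `e^{ϑH}` is integrable with respect to it for all `0 < ϑ < 1/T_max`").
Proof: for each such `ϑ`, (3.4) on `[0, 1)` and H2 at `t* = 1` give, by (3.5)–(3.6), a uniform
bound on the orbit integrals `E_z e^{ϑH(z_t)}`; `e^{ϑH}` has compact sublevel sets; the
Krylov–Bogoliubov theorem for the whole family `(e^{ϑH})_ϑ` at once
(`Literature.Probability.Process.MarkovSemigroup.exists_invariant_of_lyapunov`) gives one invariant probability measure
integrating all of them. [cite: CuneoEckmannHairerReyBellet2018, Thm 2.13 (2) and Prop 3.7] -/
theorem exists_isInvariant :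
    ∃ S : LangevinChainSemigroup (pinnedChain ω₂ lam β γ) N T_L T_R,
      (∀ (t : ℝ≥0) (g : PhaseSpace N →ᵇ ℝ), Continuous (S.act t g)) ∧
      ∃ μ : Measure (PhaseSpace N), IsProbabilityMeasure μ ∧ S.IsInvariant μ ∧
        ∀ ϑ : ℝ, 0 < ϑ → ϑ < 1 / max T_L T_R →
          Integrable (fun z => Real.exp (ϑ * (pinnedChain ω₂ lam β γ).hamiltonian N z)) μ := by
  obtain ⟨S, hF, hθ⟩ := h ω₂ lam β γ hω hl hβ hγ N T_L T_R hN hL hR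
  have hTm : 0 < 1 / max T_L T_R := by positivity
  -- the family of Lyapunov functions `e^{ϑH}`, `0 < ϑ < 1/T_max`
  let ι := {ϑ : ℝ // 0 < ϑ ∧ ϑ < 1 / max T_L T_R}
  let V : ι → PhaseSpace N → ℝ≥0 := fun ϑ x =>
    (Real.exp (ϑ.1 * (pinnedChain ω₂ lam β γ).hamiltonian N x)).toNNReal
  have hVapply : ∀ (ϑ : ι) (x : PhaseSpace N),
      (V ϑ x : ℝ≥0∞) = ENNReal.ofReal (Real.exp (ϑ.1 * (pinnedChain ω₂ lam β γ).hamiltonian N x)) :=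
    fun ϑ x => rfl
  have hV : ∀ ϑ : ι, Continuous (V ϑ) := fun ϑ =>
    continuous_real_toNNReal.comp (Real.continuous_exp.comp
      (continuous_const.mul (pinnedChain_continuous_hamiltonian ω₂ lam β γ N)))
  -- H2 at `t* = 1` and (3.4) on `[0,1)`, in the form consumed by the abstract theorem
  have hlyap : ∀ ϑ : ι, ∃ (tstar : ℝ≥0) (a b c : ℝ≥0∞), 0 < tstar ∧ a < 1 ∧ b ≠ ⊤ ∧ c ≠ ⊤ ∧
      (∀ x, ∫⁻ y, V ϑ y ∂(S.kernel tstar x) ≤ a * V ϑ x + b) ∧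
      (∀ r : ℝ≥0, r < tstar → ∀ x, ∫⁻ y, V ϑ y ∂(S.kernel r x) ≤ c * V ϑ x) := by
    intro ϑ
    obtain ⟨h34, hH2⟩ := hθ ϑ.1 ϑ.2.1 ϑ.2.2
    obtain ⟨a, c, K, ha0, ha1, hc, -, hbound⟩ := hH2 1 one_pos
    refine ⟨1, ENNReal.ofReal a, ENNReal.ofReal c,
      ENNReal.ofReal (Real.exp (ϑ.1 * γ * (T_L + T_R))), one_pos,
      ENNReal.ofReal_lt_one.2 ha1, ENNReal.ofReal_ne_top, ENNReal.ofReal_ne_top,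
      fun x => ?_, fun r hr x => ?_⟩
    · refine (hbound x).trans ?_
      rw [hVapply, ← ENNReal.ofReal_mul ha0.le,
        ← ENNReal.ofReal_add (by positivity) (by positivity)]
      refine ENNReal.ofReal_le_ofReal (add_le_add le_rfl ?_)
      calc c * K.indicator 1 x ≤ c * 1 := by
            refine mul_le_mul_of_nonneg_left ?_ hc.le
            exact Set.indicator_le_self' (fun _ _ => zero_le_one) x
        _ = c := mul_one c
    · refine (h34 r x).trans ?_
      rw [hVapply, ← ENNReal.ofReal_mul (by positivity)]
      refine ENNReal.ofReal_le_ofReal (mul_le_mul_of_nonneg_right ?_ (by positivity))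
      refine Real.exp_le_exp.2 ?_
      have hr' : ((r : ℝ≥0) : ℝ) ≤ 1 := by exact_mod_cast hr.le
      have h0 : 0 ≤ ϑ.1 * γ * (T_L + T_R) := by
        have := ϑ.2.1; positivity
      nlinarith
  -- a distinguished index with compact sublevel sets
  let ϑ₀ : ι := ⟨1 / max T_L T_R / 2, by positivity, half_lt_self hTm⟩
  have hcpt : ∀ R : ℝ≥0, IsCompact {x | V ϑ₀ x ≤ R} := fun R =>
    pinnedChain_isCompact_setOf_exp_le hω hl hβ.le γ N (θ := ϑ₀.1) (by positivity) R
  obtain ⟨μ, hμ, hinv, hfin⟩ := Literature.Probability.Process.MarkovSemigroup.exists_invariant_of_lyapunov S.kernel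
    S.kernel_zero S.kernel_add S.measurable_kernel hF V hV hlyap ϑ₀ hcpt 0
  refine ⟨S, hF, μ, hμ, hinv, fun ϑ h0 h1 => ?_⟩
  refine ⟨(Real.continuous_exp.comp (continuous_const.mul
    (pinnedChain_continuous_hamiltonian ω₂ lam β γ N))).aestronglyMeasurable, ?_⟩
  have hlt := hfin ⟨ϑ, h0, h1⟩
  simp only [hVapply] at hlt
  show ∫⁻ x, ‖Real.exp (ϑ * (pinnedChain ω₂ lam β γ).hamiltonian N x)‖ₑ ∂μ < ⊤
  simpa only [Real.enorm_eq_ofReal (Real.exp_nonneg _)] using hlt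

end CuneoEckmannHairerReyBellet2018_lyapunov

/-! ### The smooth-density fact: the printed form, and absolute continuity -/

namespace CuneoEckmannHairerReyBellet2018_smoothDensity

variable (h : CuneoEckmannHairerReyBellet2018_smoothDensity) {ω₂ lam β γ : ℝ}
  (hω : 0 < ω₂) (hl : 0 ≤ lam) (hβ : 0 < β) (hγ : 0 < γ)
  {N : ℕ} (hN : 0 < N) {T_L T_R : ℝ} (hL : 0 < T_L) (hR : 0 < T_R)
include h hω hl hβ hγ hN hL hR

/-- **Prop. 3.2, last sentence, as printed**: every invariant probability measure of a Markov
semigroup of the pinned chain has a smooth density — invariant finite measures are weakly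
stationary by Dynkin's identity (`LangevinChainSemigroup.IsInvariant.integral_generator_eq_zero`),
and the fact applies. [cite: CuneoEckmannHairerReyBellet2018, Prop 3.2] -/
theorem hasSmoothDensity_of_isInvariant
    (S : LangevinChainSemigroup (pinnedChain ω₂ lam β γ) N T_L T_R)
    (μ : Measure (PhaseSpace N)) [IsFiniteMeasure μ] (hμ : S.IsInvariant μ) :
    HasSmoothDensity μ := by
  refine h ω₂ lam β γ hω hl hβ hγ N T_L T_R hN hL hR μ inferInstance fun f hf hfc => ?_
  have hf2 : ContDiff ℝ 2 f := hf.of_le (by norm_cast)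
  exact hμ.integral_generator_eq_zero S hf hfc
    ((pinnedChain ω₂ lam β γ).continuous_generator (pinnedChain_contDiff_U ω₂ lam β γ)
      (pinnedChain_contDiff_V ω₂ lam β γ) N T_L T_R hf2).stronglyMeasurable
    ((pinnedChain ω₂ lam β γ).exists_bound_generator (pinnedChain_contDiff_U ω₂ lam β γ)
      (pinnedChain_contDiff_V ω₂ lam β γ) N T_L T_R hf2 hfc)

/-- A weak steady state of the pinned chain is absolutely continuous with respect to Lebesgue
measure (hypoellipticity of `L*`: Hörmander 1967, Thm 1.1, with the bracket condition of CEHR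
Prop. 4.1). [cite: Hormander1967, Thm 1.1] [cite: CuneoEckmannHairerReyBellet2018, Prop 4.1] -/
theorem absolutelyContinuous_of_isSteadyState (μ : Measure (PhaseSpace N))
    (hμ : (pinnedChain ω₂ lam β γ).IsSteadyState N T_L T_R μ) :
    μ ≪ (volume : Measure (PhaseSpace N)) := by
  obtain ⟨hprob, hstat, -⟩ := hμ
  exact (h ω₂ lam β γ hω hl hβ hγ N T_L T_R hN hL hR μ inferInstance hstat).absolutelyContinuous

end CuneoEckmannHairerReyBellet2018_smoothDensity

/-! ### Theorem 2.13 (1)∧(2) without uniqueness, from the two named facts -/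

/-- **Theorem 2.13 (2) with the smooth density of (1), for the pinned chain, from the two named
facts**: a Feller Markov semigroup of `pinnedChain ω₂ lam β γ` with an invariant probability
measure that has a smooth Lebesgue density and integrates `e^{ϑH}` for all
`0 < ϑ < 1/max(T_L, T_R)` (uniqueness and the exponential convergence (2.5) are NOT obtained
here). [cite: CuneoEckmannHairerReyBellet2018, Thm 2.13] -/
theorem CuneoEckmannHairerReyBellet2018_lyapunov.exists_isInvariant_hasSmoothDensity
    (h₂ : CuneoEckmannHairerReyBellet2018_lyapunov)
    (h₁ : CuneoEckmannHairerReyBellet2018_smoothDensity) {ω₂ lam β γ : ℝ}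
    (hω : 0 < ω₂) (hl : 0 ≤ lam) (hβ : 0 < β) (hγ : 0 < γ)
    {N : ℕ} (hN : 0 < N) {T_L T_R : ℝ} (hL : 0 < T_L) (hR : 0 < T_R) :
    ∃ S : LangevinChainSemigroup (pinnedChain ω₂ lam β γ) N T_L T_R,
      (∀ (t : ℝ≥0) (g : PhaseSpace N →ᵇ ℝ), Continuous (S.act t g)) ∧
      ∃ μ : Measure (PhaseSpace N), IsProbabilityMeasure μ ∧ S.IsInvariant μ ∧
        HasSmoothDensity μ ∧
        ∀ ϑ : ℝ, 0 < ϑ → ϑ < 1 / max T_L T_R →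
          Integrable (fun z => Real.exp (ϑ * (pinnedChain ω₂ lam β γ).hamiltonian N z)) μ := by
  obtain ⟨S, hF, μ, hμ, hinv, hint⟩ := h₂.exists_isInvariant hω hl hβ hγ hN hL hR
  exact ⟨S, hF, μ, hμ, hinv, h₁.hasSmoothDensity_of_isInvariant hω hl hβ hγ hN hL hR S μ hinv,
    hint⟩

/-! ### Assembly: the weak-stationarity fact from the two named facts -/

/-- **The named fact `CuneoEckmannHairerReyBellet2018_pinnedChain` follows from the Lyapunov fact
and the smooth-density fact** (sharpening `CuneoEckmannHairerReyBellet2018_pinnedChain_of_thm213`,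
which assumed all of Theorem 2.13): the invariant probability measure produced by
Krylov–Bogoliubov (`CuneoEckmannHairerReyBellet2018_lyapunov.exists_isInvariant`) integrates
`e^{ϑH}` for all `0 < ϑ < 1/max(T_L,T_R)`, hence its bond currents
(`pinnedChain_isSteadyState_of_isInvariant`), is a weak steady state by Dynkin's identity, and has
a smooth density by the hypoellipticity fact, so it is absolutely continuous.
[cite: CuneoEckmannHairerReyBellet2018, Thm 2.13] -/
theorem CuneoEckmannHairerReyBellet2018_pinnedChain_of_lyapunov_of_smoothDensity
    (h₂ : CuneoEckmannHairerReyBellet2018_lyapunov)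
    (h₁ : CuneoEckmannHairerReyBellet2018_smoothDensity) :
    CuneoEckmannHairerReyBellet2018_pinnedChain := by
  intro ω₂ lam β γ hω hl hβ hγ N T_L T_R hN hL hR
  obtain ⟨S, -, μ, hμ, hinv, hint⟩ := h₂.exists_isInvariant hω hl.le hβ hγ hN hL hR
  have hmax : 0 < max T_L T_R := lt_max_of_lt_left hL
  have hϑ0 : 0 < 1 / max T_L T_R / 2 := by positivity
  have hϑ1 : 1 / max T_L T_R / 2 < 1 / max T_L T_R := half_lt_self (by positivity)
  exact ⟨μ, pinnedChain_isSteadyState_of_isInvariant hω.le hl.le hβ.le γ N S hinv hϑ0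
      (hint _ hϑ0 hϑ1),
    (h₁.hasSmoothDensity_of_isInvariant hω hl.le hβ hγ hN hL hR S μ hinv).absolutelyContinuous,
    hint⟩

end Pinned

end Literature.MathematicalPhysics.KineticTheory.HeatConduction
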